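import Mathlib
import Literature.NumberTheory.Sieve.PolynomialCongruences

/-!
Sketch for crux idea `kummer-hyperkloosterman-kuznetsov` (crux stmt-Parity-9469, round 2, ideator 5).
First lemma (K1) `KummerRootKloosterman` and the transferred statement (C⁺) `KummerWindowCancellation`.
Nothing here is proved; the file only has to elaborate.
-/

open Polynomial

namespace Summit.Parity.BatemanHorn.Cruxes.BalancedSemiprimeLayer.KummerHyperKloosterman

/-- The twisted hyper-Kloosterman sum `Kl₃(a; 1, χ, χ̄; p) = ∑_{y,z ∈ (ℤ/p)ˣ} χ(y) χ(z)⁻¹ e((a/(yz) + y + z)/p)`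
(the `x`-variable of `xyz = a` eliminated). [folklore; Katz, *Gauss sums, Kloosterman sums and monodromy*, §4] -/
noncomputable def twistedKl3 (p : ℕ) [NeZero p] (χ : MulChar (ZMod p) ℂ) (a : ZMod p) : ℂ :=
  ∑ y : (ZMod p)ˣ, ∑ z : (ZMod p)ˣ,
    χ (y : ZMod p) * (χ (z : ZMod p))⁻¹ *
      ZMod.stdAddChar (a * ((y⁻¹ * z⁻¹ : (ZMod p)ˣ) : ZMod p) + (y : ZMod p) + (z : ZMod p))

/-- **(K1) Kummer roots are hyper-Kloosterman sums.** For the binomial cubic `g = X³ − k`, a prime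
`p ≡ 1 (mod 3)`, `p ∤ 3k`, `k` a cubic residue mod `p`, a cubic character `χ` mod `p` and a frequency
`h ≢ 0 (mod p)`: `p · S_g(h; p) = Kl₃(k h³/27; 1, χ, χ̄; p)`, where
`S_g(h; p) = ∑_{ν mod p, ν³ ≡ k} e(hν/p)` is the tree's `polyRootWeylSum`.
(Proof route: `1[ν³ = k] = (p−1)⁻¹ ∑_η η(ν³/k)`, Gauss sums, Hasse–Davenport product formula for
`τ(η³)`; verified numerically to machine precision for p ∈ {31,43,67,73}, and over `𝔽_{p²}` for the
inert primes p ∈ {5,11,17}.) -/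
def KummerRootKloosterman : Prop :=
  ∀ (p : ℕ) [NeZero p], p.Prime → p % 3 = 1 →
  ∀ (χ : MulChar (ZMod p) ℂ), χ ^ 3 = 1 → χ ≠ 1 →
  ∀ (k h : ℤ), ((3 * k : ℤ) : ZMod p) ≠ 0 → ((h : ℤ) : ZMod p) ≠ 0 → χ ((k : ℤ) : ZMod p) = 1 →
    (p : ℂ) * Literature.NumberTheory.Sieve.polyRootWeylSum (X ^ 3 - C k) p h =
      twistedKl3 p χ (((k : ℤ) : ZMod p) * ((h : ℤ) : ZMod p) ^ 3 * ((27 : ZMod p))⁻¹)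

/-- **(C⁺) Linnik-type cancellation for Kummer root sums over rough moduli in progressions** (the transferred crux
for binomial cubic coordinates `g = aX³ + b`): for some `η > 0` and every roughness exponent `c`, the root Weyl sums of the
DILATED binomial `g(eX) = a e³ X³ + b` (dilation by the sieve modulus `e` is what the CRT reduction of S8's progression condition
`n ≡ s (mod e)` produces; the Kummer shape is preserved) cancel over the squarefree moduli `m ∈ (M, 2M]` with all prime factors
`> M^c` lying in a fixed class `m ≡ u (mod e)`, `e ≤ M^{η/2}` (the Vaaler cut-off for one class mod `me` is `H ≍ e·M^{1/3}x^{o(1)}`, hence the frequency range `M^{1/3+η}`), with a saving of exponent `> 1/3` against the Deligne-trivial bound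
`≍ M/e`, uniformly in the frequency `0 < |h| ≤ M^{1/3+η}`. With `c₀ < η/8` this gives the input `INC(g, ·)` of the dead lines
(seat -3 dead file §3 (O2), §4(i)) restricted to Kummer `g`, hence S8 for Kummer `g` by the tree's Erdős–Turán/Vaaler plumbing.
By (K1) and CRT the summand `m · S_{g(eX)}(h; m)` is a product of local twisted hyper-Kloosterman sums `Kl₃`, i.e. the sum is the
geometric side of a `w₅`-Kuznetsov formula in the modulus aspect (Buttcane 2023, for SL₃(ℤ); here on the cubic cover over ℚ(ω)). -/
def KummerWindowCancellation : Prop :=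
  ∀ (a b : ℤ), 0 < a → b ≠ 0 → Irreducible (C a * X ^ 3 + C b) →
    ∃ η : ℝ, 0 < η ∧ ∀ c : ℝ, 0 < c → c ≤ 1 / 10 → ∃ K : ℝ,
      ∀ (M e u : ℕ) (h : ℤ), 2 ≤ M → 1 ≤ e → (e : ℝ) ≤ (M : ℝ) ^ (η / 2) → h ≠ 0 → (|h| : ℝ) ≤ (M : ℝ) ^ (1 / 3 + η) →
        ‖∑ m ∈ (Finset.Ioc M (2 * M)).filter
              (fun m => Squarefree m ∧ m ≡ u [MOD e] ∧ ∀ q ∈ m.primeFactors, (M : ℝ) ^ c < (q : ℝ)),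
            Literature.NumberTheory.Sieve.polyRootWeylSum (C (a * (e : ℤ) ^ 3) * X ^ 3 + C b) m h‖
          ≤ K * (M : ℝ) ^ (2 / 3 - η)

end Summit.Parity.BatemanHorn.Cruxes.BalancedSemiprimeLayer.KummerHyperKloosterman
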